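import Literature.NumberTheory.Automorphic.CompletedCohomologyHeckeAlgebraGLn
import HarnessLib

/-!
# Galois representations attached to torsion Hecke eigensystems of `GL_n` (Scholze): the named facts

Leaf module of `Literature.NumberTheory.Automorphic.CompletedCohomologyHeckeAlgebraGLn` (the
completed-cohomology Hecke algebra `𝕋(K^p)` of `GL_n`, a VOCABULARY file). It holds, verbatim and
under their original fully-qualified names
`Literature.NumberTheory.Automorphic.BigHeckeGLn.TameLevel.residualRep_exists` and
`Literature.NumberTheory.Automorphic.BigHeckeGLn.TameLevel.bigGaloisRep_modNilpotent_exists`, the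
two NAMED FACTS (published theorems, not proved in the tree) that used to close that file:

* `TameLevel.residualRep_exists 𝒰` (`K` totally real) — for every finite level `(r, s, i)` and every
  eigensystem `ψ : 𝕋(U_r, s, i) → k` into an algebraically closed discrete field there is a
  continuous `ρ̄_ψ : Γ_K → GL_n(k)`, unramified outside `S`, with `charpoly ρ̄_ψ(Frob_v) = ψ(P_v)`
  for `v ∉ S` [cite: Scholze2015, Thm. V.4.1 and Cor. V.4.3];
* `TameLevel.bigGaloisRep_modNilpotent_exists 𝒰` (`K` totally real) — for `𝕋(K^p)` commutative and
  `𝔪` non-Eisenstein maximal there are a nilpotent ideal `J ⊆ 𝕋(K^p)_𝔪` and a continuous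
  `ρ : Γ_K → GL_n(𝕋(K^p)_𝔪 / J)` with `charpoly ρ(Frob_v) = P_v mod J` for `v ∉ S`
  [cite: GeeNewton2020, §3.3, Rem. 3.3.3], from [cite: Scholze2015, Cor. V.4.4 and Rem. V.4.5].

Why a separate module (cone hygiene, 2026-08-17): the vocabulary file is imported by every route
that types `p`-adic automorphy (`TameLevel.IsPadicallyAutomorphic`), and none of those statements
uses these two existence theorems; keeping them here keeps the vocabulary cone free of unproved
named facts. Statements, docstrings and citations are unchanged (see the vocabulary file's module
docstring, "Conventions", for the Frobenius normalisation and the dependence, in print, on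
Arthur's endoscopic classification, [cite: Scholze2015, Rem. V.4.6]). Users take them as explicit
hypotheses `(h : 𝒰.residualRep_exists)`; nothing in `Literature/` currently does.

## References

* P. Scholze, *On torsion in the cohomology of locally symmetric varieties*, Ann. of Math. 182
  (2015), Thm. V.4.1, Cor. V.4.3, Cor. V.4.4, Rem. V.4.5–V.4.6 [Scholze2015].
* T. Gee, J. Newton, *Patching and the completed homology of locally symmetric spaces*, J. Inst.
  Math. Jussieu (2020), §3.3 [GeeNewton2020].
-/

noncomputable section

open scoped NumberField
open IsDedekindDomain

namespace Literature.NumberTheory.Automorphic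

namespace BigHeckeGLn

namespace TameLevel

variable {n : ℕ} {K : Type} [Field K] [NumberField K] {p : ℕ} [Fact p.Prime]

/-- **Named fact (Scholze): Galois representations for torsion eigensystems, `K` totally
real.** For every finite level `(r, s, i)` and every ring homomorphism `ψ : 𝕋(U_r, s, i) → k` to
an algebraically closed (discrete) field, there is a continuous `ρ̄_ψ : Γ_K → GL_n(k)`, unramified
outside `S`, with `charpoly ρ̄_ψ(Frob_v) = ψ(P_v)` for all `v ∉ S`
[cite: Scholze2015, Thm. V.4.1 and Cor. V.4.3] (for `F = K` totally real the hypotheses on `S`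
there — finite, containing all `v ∣ p` — are exactly those of `TameLevel`, and `U_r = K_S K^S`;
the `n`-dimensional continuous determinant with values in `𝕋_{F,S}(K,i,m)/I`, `I` nilpotent,
composed with `ψ` gives `ρ̄_ψ` by Chenevier's theorem as in the proof of Cor. V.4.3; stated here
in the arithmetic-Frobenius / Gee–Newton normalisation, equivalent to Scholze's by duality and a
cyclotomic twist, see the module docstring; conditional in print on Arthur's endoscopic
classification, loc. cit. Rem. V.4.6). The CM case (extra hypotheses: `S` stable under complex
conjugation and containing the places ramified over `K⁺`) is not vendored here. -/
def residualRep_exists (𝒰 : TameLevel n K p) [NumberField.IsTotallyReal K] : Prop :=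
  ∀ (idx : ℕ × ℕ × ℕ) (k : Type) [Field k] [IsAlgClosed k] [TopologicalSpace k]
    [DiscreteTopology k] (ψ : 𝒰.levelHeckeSubring idx →+* k),
    ∃ ρ : Literature.NumberTheory.GaloisRepresentations.FramedGaloisRep K k n,
      IsAssociatedFamily n 𝒰.bad (fun v i => ψ (𝒰.levelHeckeT idx v i)) ρ

/-- **Named fact (Scholze, as recorded by Gee–Newton): `ρ_𝔪` exists modulo a nilpotent ideal,
`K` totally real.** For `𝕋(K^p)` commutative (`h`) and `𝔪` a non-Eisenstein maximal ideal there
are a NILPOTENT ideal `J ⊆ 𝕋(K^p)_𝔪` and a continuous `ρ : Γ_K → GL_n(𝕋(K^p)_𝔪/J)` with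
`charpoly ρ(Frob_v) = P_v mod J` for all `v ∉ S` [cite: GeeNewton2020, §3.3, Rem. 3.3.3] ("it
follows from Scholze's work (`F` CM or totally real) that there is a lifting of `ρ̄_𝔪` valued in
`𝕋^S(U^p)_𝔪/I` for some nilpotent ideal `I`"; from [cite: Scholze2015, Cor. V.4.4 and Rem. V.4.5],
nilpotence degree bounded by `N([K:ℚ], n)`; Gee–Newton work with `PGL_n` and endomorphisms of
complexes, of which the cohomological `𝕋` is a quotient by a nilpotent ideal; their sharper
`I⁴ = 0` via Newton–Thorne concerns CM fields and is not claimed). -/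
def bigGaloisRep_modNilpotent_exists (𝒰 : TameLevel n K p) [NumberField.IsTotallyReal K] : Prop :=
  ∀ (h : 𝒰.heckeGenerators_commute) (𝔪 : Ideal (CompletedCohomologyHeckeAlgebraGLn 𝒰))
    (_ : 𝔪.IsMaximal), 𝒰.IsNonEisenstein 𝔪 →
    ∃ (J : Ideal (Localized 𝒰 h 𝔪)) (ρ : Literature.NumberTheory.GaloisRepresentations.FramedGaloisRep
      K (Localized 𝒰 h 𝔪 ⧸ J) n), IsNilpotent J ∧
      IsAssociatedFamily n 𝒰.bad
        (fun v i => Ideal.Quotient.mk J (Localized.of 𝒰 h 𝔪 (𝒰.heckeT v i))) ρ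

end TameLevel

end BigHeckeGLn

end Literature.NumberTheory.Automorphic
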